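import Literature.NumberTheory.GaloisCohomology.Howard2004.DVRKolyvaginBoundProofs
import Mathlib.Algebra.Module.Torsion.Basic
import HarnessLib

/-!
# Howard 2004, Theorem 1.6.1, conclusion (ii) «`H¹_F(K, A) ≅ 𝒟 ⊕ M ⊕ M`» — the colimit algebra, I:
# the divisible part `𝒟 = Frac(R)/R` (theorems only; no definition, no named fact, no instance, no `sorry`)

Source: B. Howard, *The Heegner point Kolyvagin system*, Compositio Math. **140** (2004), Thm. 1.6.1
(= arXiv:1202.6340 Thm. 2.6.1, p. 11 L23–28), proof p. 12 L40–48: «… `H¹_F(K, A) ≅ lim→ H¹_F(K, T^{(k)})`,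
the level `k` term being `≅ R/𝔪^{e_k} ⊕ M^{(k)} ⊕ M^{(k)}` [Thm. 1.4.2, Prop. 1.5.5 with `ε = 1`] and equal to the
`𝔪^{e_k}`-torsion of the limit [Lemma 1.3.3]; hence `H¹_F(K, A) ≅ 𝒟 ⊕ M ⊕ M` with `M = M^{(k)}` for `k ≫ 0`.»

THIS FILE and its sequel `DivisibleTorsionLevelStructureProofs` isolate and prove the PURE COMMUTATIVE ALGEBRA
of that step, over a discrete valuation ring `R` with uniformizer `π` (`𝔪 = (π)`), in the currency of
`Howard2004.DVRSetting.Conclusion` (ii) (`FracModR R = Frac(R)/R` for `𝒟`).  Here, part I: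

* §0 arithmetic in `R`, `R/𝔪^e` and `Frac(R)/R` (`𝔪^n = (π^n)`, `r/π^m ∈ R ↔ π^m ∣ r`, …);
* §A `exists_linearEquiv_fracModR_of_cyclicTorsionLevels` — an `𝔪`-power-torsion `R`-module `D` all of whose
  torsion levels `D[π^n]` are cyclic with a generator of annihilator exactly `𝔪^n` is `≃ₗ[R] 𝒟`
  (compatible generators `π g_{n+1} = g_n` by `exists_compatible_generators` of `DVRKolyvaginBoundProofs` §D,
  then `r · g_n ↦ r/π^{n+1} mod R`; well defined, additive, `R`-linear, injective, and onto because every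
  element of `Frac(R)` is `a/(u π^m)`).
Part II (the sequel) decomposes an `X` with levels `X[π^{e_k}] ≅ R/𝔪^{e_k} × (M_k × M_k)`, `π^c M_k = 0`, as
`X ≃ₗ[R] 𝒟 × (M_k × M_k)` for every `k` with `2c ≤ e_k`.

HONEST FRAMING: this is NOT `thm161_dvrKolyvaginBound`: the levelwise structure (Thm. 1.4.2 / Prop. 1.5.5), the
identification of the levels with the torsion of `H¹_F(K, A)` (Lemma 1.3.3), Lemma 1.6.4 and the `DVRSetting` glue
remain.  No summit statement is proved; the Birch–Swinnerton-Dyer conjecture is not proved by any of this.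
-/

set_option autoImplicit false

noncomputable section

namespace Literature.NumberTheory.GaloisCohomology.Howard2004

/-! ## §0. Arithmetic in a DVR with `𝔪 = (π)`, in `R/𝔪^e`, and in `𝒟 = Frac(R)/R` -/

section Arith

variable {R : Type} [CommRing R] [IsDomain R] [IsDiscreteValuationRing R] {π : R}

/-- `𝔪^n = (π^n)`: membership is divisibility by `π^n` (arithmetic of the DVR `R` used throughout the proof of
Thm. 1.6.1). [cite: Howard2004HeegnerKolyvagin, Thm. 1.6.1, proof (arXiv p. 12, L40–48)] -/
theorem mem_maximalIdeal_pow_iff_pow_dvd (hunif : IsLocalRing.maximalIdeal R = Ideal.span {π}) (n : ℕ)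
    (r : R) : r ∈ IsLocalRing.maximalIdeal R ^ n ↔ π ^ n ∣ r := by
  rw [hunif, Ideal.span_singleton_pow, Ideal.mem_span_singleton]

/-- A uniformizer is non-zero. [folklore] -/
private theorem uniformizer_ne_zero (hunif : IsLocalRing.maximalIdeal R = Ideal.span {π}) : π ≠ 0 := fun h =>
  IsDiscreteValuationRing.not_a_field R (by rw [hunif, h, Ideal.span_singleton_eq_bot])

/-- Cancellation of powers of the uniformizer: `π^(n+m) ∣ π^n · r → π^m ∣ r` (arithmetic of the DVR `R` used in
the proof of Thm. 1.6.1). [cite: Howard2004HeegnerKolyvagin, Thm. 1.6.1, proof (arXiv p. 12, L40–48)] -/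
theorem pow_dvd_of_pow_add_dvd_pow_mul (hunif : IsLocalRing.maximalIdeal R = Ideal.span {π}) {n m : ℕ}
    {r : R} (h : π ^ (n + m) ∣ π ^ n * r) : π ^ m ∣ r := by
  rw [pow_add] at h
  exact (mul_dvd_mul_iff_left (pow_ne_zero n (uniformizer_ne_zero hunif))).mp h

/-- In `R/𝔪^e` (`𝔪 = (π)`): `π^n · ā = 0` with `n ≤ e` forces `π^(e-n) ∣ a` for ANY lift `a` — the `𝔪^n`-torsion
of `R/𝔪^e` is `𝔪^(e-n)/𝔪^e` (the free coordinate of the levels `R/𝔪^{e_k} ⊕ M ⊕ M` in the proof of Thm. 1.6.1).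
[cite: Howard2004HeegnerKolyvagin, Thm. 1.6.1, proof (arXiv p. 12, L40–48)] -/
theorem pow_sub_dvd_of_pow_smul_mk_eq_zero (hunif : IsLocalRing.maximalIdeal R = Ideal.span {π}) {e n : ℕ}
    (hn : n ≤ e) {a : R}
    (h : π ^ n • (Ideal.Quotient.mk (IsLocalRing.maximalIdeal R ^ e) a) = 0) : π ^ (e - n) ∣ a := by
  rw [Algebra.smul_def, Ideal.Quotient.algebraMap_eq, ← map_mul, Ideal.Quotient.eq_zero_iff_mem,
    mem_maximalIdeal_pow_iff_pow_dvd hunif, ← Nat.add_sub_cancel' hn] at h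
  exact pow_dvd_of_pow_add_dvd_pow_mul hunif h

omit [IsDomain R] [IsDiscreteValuationRing R] in
/-- `r · 1̄ = r̄` in `R/I` as an `R`-module (the free coordinate `R/𝔪^{e_k}` of a level in the proof of
Thm. 1.6.1). [cite: Howard2004HeegnerKolyvagin, Thm. 1.6.1, proof (arXiv p. 12, L40–48)] -/
theorem smul_one_eq_mk (I : Ideal R) (r : R) : r • (1 : R ⧸ I) = Ideal.Quotient.mk I r := by
  rw [← Ideal.Quotient.algebraMap_eq, Algebra.algebraMap_eq_smul_one]

/-- The annihilator of `1̄ ∈ R/𝔪^e` is `𝔪^e` (the free coordinate `R/𝔪^{e_k}` of a level in the proof of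
Thm. 1.6.1). [cite: Howard2004HeegnerKolyvagin, Thm. 1.6.1, proof (arXiv p. 12, L40–48)] -/
theorem smul_one_quot_eq_zero_iff (e : ℕ) (r : R) :
    r • (1 : R ⧸ IsLocalRing.maximalIdeal R ^ e) = 0 ↔ r ∈ IsLocalRing.maximalIdeal R ^ e := by
  rw [smul_one_eq_mk, Ideal.Quotient.eq_zero_iff_mem]

/-- The image of the uniformizer in `Frac(R)` is non-zero. [folklore] -/
private theorem algebraMap_uniformizer_ne_zero (hunif : IsLocalRing.maximalIdeal R = Ideal.span {π}) :
    algebraMap R (FractionRing R) π ≠ 0 := fun h =>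
  uniformizer_ne_zero hunif ((IsFractionRing.injective R (FractionRing R)) (by rw [h, map_zero]))

/-- `r/π^m ∈ R ⊂ Frac(R)` iff `π^m ∣ r`. [folklore] -/
private theorem div_pow_mem_one_iff (hunif : IsLocalRing.maximalIdeal R = Ideal.span {π}) (r : R) (m : ℕ) :
    algebraMap R (FractionRing R) r / algebraMap R (FractionRing R) π ^ m ∈
        (1 : Submodule R (FractionRing R)) ↔ π ^ m ∣ r := by
  have hπK : algebraMap R (FractionRing R) π ^ m ≠ 0 := pow_ne_zero m (algebraMap_uniformizer_ne_zero hunif)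
  rw [Submodule.mem_one]
  constructor
  · rintro ⟨s, hs⟩
    rw [eq_div_iff hπK, ← map_pow, ← map_mul] at hs
    exact ⟨s, by rw [mul_comm]; exact ((IsFractionRing.injective R (FractionRing R)) hs).symm⟩
  · rintro ⟨s, rfl⟩
    exact ⟨s, by rw [map_mul, map_pow, mul_div_cancel_left₀ _ hπK]⟩

/-- `r/π^m = (r π^i)/π^(m+i)` in `Frac(R)`. [folklore] -/
private theorem div_pow_eq_mul_pow_div_pow_add (hunif : IsLocalRing.maximalIdeal R = Ideal.span {π}) (r : R)
    (m i : ℕ) :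
    algebraMap R (FractionRing R) r / algebraMap R (FractionRing R) π ^ m =
      algebraMap R (FractionRing R) (r * π ^ i) / algebraMap R (FractionRing R) π ^ (m + i) := by
  rw [map_mul, map_pow, pow_add,
    mul_div_mul_right _ _ (pow_ne_zero i (algebraMap_uniformizer_ne_zero hunif))]

/-- In `𝒟 = Frac(R)/R`: `[a/π^m] = [b/π^m]` as soon as `π^m ∣ a - b`. [folklore] -/
private theorem mkQ_div_pow_eq_of_dvd_sub (hunif : IsLocalRing.maximalIdeal R = Ideal.span {π}) {a b : R} {m : ℕ}
    (h : π ^ m ∣ a - b) :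
    (1 : Submodule R (FractionRing R)).mkQ
        (algebraMap R (FractionRing R) a / algebraMap R (FractionRing R) π ^ m) =
      (1 : Submodule R (FractionRing R)).mkQ
        (algebraMap R (FractionRing R) b / algebraMap R (FractionRing R) π ^ m) := by
  rw [Submodule.mkQ_apply, Submodule.mkQ_apply, Submodule.Quotient.eq, ← sub_div, ← map_sub]
  exact (div_pow_mem_one_iff hunif _ _).mpr h

/-- `(s r)/π^m = s · (r/π^m)` in `Frac(R)`. [folklore] -/
private theorem div_pow_mul_left (s r : R) (m : ℕ) :
    algebraMap R (FractionRing R) (s * r) / algebraMap R (FractionRing R) π ^ m =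
      s • (algebraMap R (FractionRing R) r / algebraMap R (FractionRing R) π ^ m) := by
  rw [map_mul, Algebra.smul_def, mul_div_assoc]

end Arith

/-! ## §A. `𝔪`-power-torsion modules with cyclic torsion levels are `𝒟 = Frac(R)/R` (p. 12 L44–48) -/

section DivisibleModule

variable {R : Type} [CommRing R] [IsDomain R] [IsDiscreteValuationRing R] {π : R}
  {D : Type*} [AddCommGroup D] [Module R D]

/-- **Compatible generators of the torsion levels.**  If `D` is an `R`-module (`R` a DVR, `𝔪 = (π)`) and
every torsion level `D[π^n]` is generated by an element with annihilator exactly `𝔪^n`, then there are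
generators `g_n` of `D[π^(n+1)]`, `ann(g_n) = 𝔪^(n+1)`, with `π · g_(n+1) = g_n` — the levels of the divisible
module `𝒟 ⊂ H¹_F(K, A)` chosen coherently (via `exists_compatible_generators`).
[cite: Howard2004HeegnerKolyvagin, Thm. 1.6.1, proof (arXiv p. 12, L44–48)] -/
theorem exists_compatible_torsion_generators (hunif : IsLocalRing.maximalIdeal R = Ideal.span {π})
    (hlev : ∀ n : ℕ, ∃ y : D, (∀ r : R, r • y = 0 ↔ r ∈ IsLocalRing.maximalIdeal R ^ n) ∧
      ∀ x : D, π ^ n • x = 0 → ∃ r : R, x = r • y) :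
    ∃ G : ℕ → D, (∀ n, ∀ r : R, r • G n = 0 ↔ r ∈ IsLocalRing.maximalIdeal R ^ (n + 1)) ∧
      (∀ n, ∀ x : D, π ^ (n + 1) • x = 0 → ∃ r : R, x = r • G n) ∧ ∀ n, π • G (n + 1) = G n := by
  have hmemT : ∀ (m : ℕ) (x : D), x ∈ Submodule.torsionBy R D (π ^ m) ↔ π ^ m • x = 0 :=
    fun m x => Submodule.mem_torsionBy_iff _ _
  -- an element with annihilator `𝔪^m` is killed by `π^m`
  have hkill : ∀ (m : ℕ) (y : D), (∀ r : R, r • y = 0 ↔ r ∈ IsLocalRing.maximalIdeal R ^ m) →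
      π ^ m • y = 0 := fun m y hy => (hy _).mpr (Ideal.pow_mem_pow (by
        rw [hunif]; exact Ideal.mem_span_singleton_self π) m)
  have hred : ∀ (k : ℕ) (y : ↥(Submodule.torsionBy R D (π ^ (k + 1 + 1)))),
      π • (y : D) ∈ Submodule.torsionBy R D (π ^ (k + 1)) := by
    intro k y
    rw [hmemT, smul_smul, ← pow_succ, ← hmemT]
    exact y.2
  let red : ∀ k : ℕ, ↥(Submodule.torsionBy R D (π ^ (k + 1 + 1))) →ₗ[R]
      ↥(Submodule.torsionBy R D (π ^ (k + 1))) :=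
    fun k => LinearMap.codRestrict _ ((π • (LinearMap.id : D →ₗ[R] D)).comp (Submodule.subtype _))
      (fun y => hred k y)
  have hred_apply : ∀ (k : ℕ) (y : ↥(Submodule.torsionBy R D (π ^ (k + 1 + 1)))),
      ((red k y : ↥(Submodule.torsionBy R D (π ^ (k + 1)))) : D) = π • (y : D) := fun k y => rfl
  -- the transitions are onto: `x = r y`, `π^(k+1) x = 0` forces `π ∣ r`
  have hsurj : ∀ k, Function.Surjective (red k) := by
    intro k x
    obtain ⟨y, hyann, hygen⟩ := hlev (k + 1 + 1)
    have hx2 : π ^ (k + 1 + 1) • (x : D) = 0 := by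
      rw [pow_succ, mul_comm, mul_smul, (hmemT _ _).mp x.2, smul_zero]
    obtain ⟨r, hr⟩ := hygen x hx2
    have hdvd : π ^ 1 ∣ r := by
      refine pow_dvd_of_pow_add_dvd_pow_mul hunif (n := k + 1) ?_
      rw [← mem_maximalIdeal_pow_iff_pow_dvd hunif, ← hyann, mul_smul, ← hr]
      exact (hmemT _ _).mp x.2
    obtain ⟨r', rfl⟩ := hdvd
    have hmem : r' • y ∈ Submodule.torsionBy R D (π ^ (k + 1 + 1)) := by
      rw [hmemT, smul_comm, hkill _ y hyann, smul_zero]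
    refine ⟨⟨r' • y, hmem⟩, Subtype.ext ?_⟩
    rw [hred_apply, hr, pow_one, smul_smul]
  -- each level is cyclic with a generator of annihilator `𝔪^(k+1)`
  have hE : ∀ k, ∃ g : ↥(Submodule.torsionBy R D (π ^ (k + 1))),
      (∀ r : R, r • g = 0 ↔ r ∈ IsLocalRing.maximalIdeal R ^ (k + 1)) ∧
      ∀ y : ↥(Submodule.torsionBy R D (π ^ (k + 1))), ∃ r : R, y = r • g := by
    intro k
    obtain ⟨y, hyann, hygen⟩ := hlev (k + 1)
    refine ⟨⟨y, (hmemT _ _).mpr (hkill _ y hyann)⟩, fun r => ?_, fun y' => ?_⟩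
    · rw [Subtype.ext_iff, Submodule.coe_smul, Submodule.coe_zero]
      exact hyann r
    · obtain ⟨r, hr⟩ := hygen y' ((hmemT _ _).mp y'.2)
      exact ⟨r, Subtype.ext (by rw [Submodule.coe_smul]; exact hr)⟩
  obtain ⟨g, hg, hgen, hgc⟩ := exists_compatible_generators
    (E := fun k => ↥(Submodule.torsionBy R D (π ^ (k + 1)))) red hsurj (fun k => k + 1)
    (fun k => Nat.succ_pos k) hE
  refine ⟨fun n => (g n : D), fun n r => ?_, fun n x hx => ?_, fun n => ?_⟩
  · rw [← hg n r, Subtype.ext_iff, Submodule.coe_smul, Submodule.coe_zero]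
  · obtain ⟨r, hr⟩ := hgen n ⟨x, (hmemT _ _).mpr hx⟩
    exact ⟨r, by rw [Subtype.ext_iff, Submodule.coe_smul] at hr; exact hr⟩
  · rw [← hred_apply, hgc n]

omit [IsDomain R] [IsDiscreteValuationRing R] in
/-- Compatible generators read downwards: `g_i = π^(j-i) · g_j` for `i ≤ j`. [folklore] -/
private theorem generator_eq_pow_smul_of_le {G : ℕ → D} (hG : ∀ n, π • G (n + 1) = G n) {i j : ℕ}
    (hij : i ≤ j) : G i = π ^ (j - i) • G j := by
  induction j, hij using Nat.le_induction with
  | base => rw [Nat.sub_self, pow_zero, one_smul]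
  | succ j hij ih => rw [ih, ← hG j, smul_smul, ← pow_succ, Nat.succ_sub hij]

/-- **`D ≅ 𝒟 = Frac(R)/R`** for an `𝔪`-power-torsion `R`-module `D` (`R` a DVR, `𝔪 = (π)`) all of whose torsion
levels `D[π^n]` are cyclic on a generator with annihilator exactly `𝔪^n`: the abstract form of «the `𝒟` in
`H¹_F(K, A) ≅ 𝒟 ⊕ M ⊕ M`», `r · g_n ↦ r/π^(n+1) mod R` along compatible generators.
[cite: Howard2004HeegnerKolyvagin, Thm. 1.6.1, proof (arXiv p. 12, L44–48)] -/
theorem exists_linearEquiv_fracModR_of_cyclicTorsionLevels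
    (hunif : IsLocalRing.maximalIdeal R = Ideal.span {π})
    (htors : ∀ x : D, ∃ n : ℕ, π ^ n • x = 0)
    (hlev : ∀ n : ℕ, ∃ y : D, (∀ r : R, r • y = 0 ↔ r ∈ IsLocalRing.maximalIdeal R ^ n) ∧
      ∀ x : D, π ^ n • x = 0 → ∃ r : R, x = r • y) :
    Nonempty (D ≃ₗ[R] FracModR R) := by
  obtain ⟨G, hGann, hGgen, hGsucc⟩ := exists_compatible_torsion_generators hunif hlev
  -- notation: `frac r m = r / π^m ∈ Frac(R)`, `cls = mod R`
  let K := FractionRing R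
  let frac : R → ℕ → K := fun r m => algebraMap R K r / algebraMap R K π ^ m
  let cls : K → FracModR R := fun q => (1 : Submodule R K).mkQ q
  -- a choice of representation `x = c_x · G_(n_x)` for every `x`
  have hn : ∀ x : D, π ^ (Classical.choose (htors x) + 1) • x = 0 := fun x => by
    rw [pow_succ, mul_comm, mul_smul, Classical.choose_spec (htors x), smul_zero]
  let n : D → ℕ := fun x => Classical.choose (htors x)
  let c : D → R := fun x => Classical.choose (hGgen (n x) x (hn x))
  have hc : ∀ x : D, x = c x • G (n x) := fun x => Classical.choose_spec (hGgen (n x) x (hn x))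
  let ψ : D → FracModR R := fun x => cls (frac (c x) (n x + 1))
  -- KEY: `ψ` does not depend on the representation
  have hkey : ∀ (x : D) (m : ℕ) (r : R), x = r • G m → ψ x = cls (frac r (m + 1)) := by
    intro x m r hr
    set j := max m (n x) with hj
    have h1 : x = (r * π ^ (j - m)) • G j := by
      rw [hr, generator_eq_pow_smul_of_le hGsucc (le_max_left m (n x)), smul_smul]
    have h2 : x = (c x * π ^ (j - n x)) • G j := by
      conv_lhs => rw [hc x, generator_eq_pow_smul_of_le hGsucc (le_max_right m (n x))]
      rw [smul_smul]
    have hdvd : π ^ (j + 1) ∣ c x * π ^ (j - n x) - r * π ^ (j - m) := by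
      rw [← mem_maximalIdeal_pow_iff_pow_dvd hunif, ← hGann j, sub_smul, ← h1, ← h2, sub_self]
    show cls (frac (c x) (n x + 1)) = cls (frac r (m + 1))
    have e1 : n x + 1 + (j - n x) = j + 1 := by omega
    have e2 : m + 1 + (j - m) = j + 1 := by omega
    rw [show frac (c x) (n x + 1) = frac (c x * π ^ (j - n x)) (j + 1) from by
        rw [← e1]; exact div_pow_eq_mul_pow_div_pow_add hunif _ _ _,
      show frac r (m + 1) = frac (r * π ^ (j - m)) (j + 1) from by
        rw [← e2]; exact div_pow_eq_mul_pow_div_pow_add hunif _ _ _]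
    exact mkQ_div_pow_eq_of_dvd_sub hunif hdvd
  -- two elements are represented on a common generator
  have hcommon : ∀ x y : D, ∃ (j : ℕ) (a b : R), x = a • G j ∧ y = b • G j := by
    intro x y
    refine ⟨max (n x) (n y), c x * π ^ (max (n x) (n y) - n x), c y * π ^ (max (n x) (n y) - n y),
      ?_, ?_⟩
    · conv_lhs => rw [hc x, generator_eq_pow_smul_of_le hGsucc (le_max_left (n x) (n y))]
      rw [smul_smul]
    · conv_lhs => rw [hc y, generator_eq_pow_smul_of_le hGsucc (le_max_right (n x) (n y))]
      rw [smul_smul]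
  have hadd : ∀ x y : D, ψ (x + y) = ψ x + ψ y := by
    intro x y
    obtain ⟨j, a, b, ha, hb⟩ := hcommon x y
    rw [hkey x j a ha, hkey y j b hb, hkey (x + y) j (a + b) (by rw [ha, hb, add_smul])]
    show cls (frac (a + b) (j + 1)) = cls (frac a (j + 1)) + cls (frac b (j + 1))
    rw [← map_add]
    congr 1
    show algebraMap R K (a + b) / _ = _
    rw [map_add, add_div]
  have hsmul : ∀ (s : R) (x : D), ψ (s • x) = s • ψ x := by
    intro s x
    rw [hkey x (n x) (c x) (hc x), hkey (s • x) (n x) (s * c x) (by rw [mul_smul, ← hc x])]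
    show cls (frac (s * c x) (n x + 1)) = s • cls (frac (c x) (n x + 1))
    rw [← map_smul]
    congr 1
    exact div_pow_mul_left s (c x) (n x + 1)
  let ψl : D →ₗ[R] FracModR R := { toFun := ψ, map_add' := hadd, map_smul' := hsmul }
  have hinj : Function.Injective ψl := by
    refine (injective_iff_map_eq_zero ψl).mpr fun x hx => ?_
    have hx' : cls (frac (c x) (n x + 1)) = 0 := by rw [← hkey x (n x) (c x) (hc x)]; exact hx
    have hmem : frac (c x) (n x + 1) ∈ (1 : Submodule R K) := by
      rwa [← Submodule.Quotient.mk_eq_zero, ← Submodule.mkQ_apply]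
    obtain ⟨s, hs⟩ := (div_pow_mem_one_iff hunif _ _).mp hmem
    rw [hc x, hs, mul_comm, mul_smul, (Submodule.mem_torsionBy_iff _ _).mp
      ((Submodule.mem_torsionBy_iff _ _).mpr ((hGann (n x) _).mpr (Ideal.pow_mem_pow (by
        rw [hunif]; exact Ideal.mem_span_singleton_self π) _))), smul_zero]
  have hsurj : Function.Surjective ψl := by
    intro q
    obtain ⟨z, rfl⟩ := Submodule.mkQ_surjective (1 : Submodule R K) q
    obtain ⟨a, b, hb, rfl⟩ := IsFractionRing.div_surjective (A := R) z
    have hb0 : b ≠ 0 := nonZeroDivisors.ne_zero hb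
    obtain ⟨m, u, rfl⟩ := IsDiscreteValuationRing.eq_unit_mul_pow_irreducible hb0
      ((IsDiscreteValuationRing.irreducible_iff_uniformizer π).mpr hunif)
    -- `a/(u π^m) = (a u⁻¹ π)/π^(m+1) = ψ ((a u⁻¹ π) · G_m)`
    refine ⟨(a * ↑u⁻¹ * π) • G m, ?_⟩
    show ψ _ = _
    rw [hkey _ m (a * ↑u⁻¹ * π) rfl]
    show cls (frac (a * ↑u⁻¹ * π) (m + 1)) = cls _
    congr 1
    show algebraMap R K (a * ↑u⁻¹ * π) / algebraMap R K π ^ (m + 1) = algebraMap R K a / algebraMap R K _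
    have hπK : algebraMap R K π ≠ 0 := algebraMap_uniformizer_ne_zero hunif
    have huK : algebraMap R K (u : R) ≠ 0 := fun h =>
      (Units.ne_zero u) ((IsFractionRing.injective R K) (by rw [h, map_zero]))
    rw [div_eq_div_iff (pow_ne_zero _ hπK) (by
      rw [map_mul, map_pow]; exact mul_ne_zero huK (pow_ne_zero _ hπK))]
    rw [map_mul, map_mul, map_mul, map_pow, pow_succ]
    have hu : algebraMap R K (u : R) * algebraMap R K (↑u⁻¹ : R) = 1 := by
      rw [← map_mul, Units.mul_inv, map_one]
    linear_combination (algebraMap R K a * algebraMap R K π ^ m * algebraMap R K π) * hu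
  exact ⟨LinearEquiv.ofBijective ψl ⟨hinj, hsurj⟩⟩

end DivisibleModule

end Literature.NumberTheory.GaloisCohomology.Howard2004
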